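import Mathlib
import Summits.ValiantsHypothesis.ValiantsHypothesis.Theorems.FifoMatchingNNLinearDegreeCofactorHardShedWordGates
import HarnessLib

/-!
# Crux `NNLinearDegreeCofactorHard` (stmt-ValiantsHypothesis-23918), line `internal_cofactor`, stub S2b (ii):
# μ* = shedWord — DYNAMICS of the look-ahead chain (the engine of the gate attribution)

For a band bit string (`|fairWalk| < w ≤ F₀` on `[H, E]`, so the queue always holds an S-item there):

* `pops_closeTime`, `shedLetter_closeTime`, `le_closeTime_iff` — the pop of item `k` happens at `closeTime k`, a pop letter;
* `pops_eq_of_defects` — pops do not move across a run of defects;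
* `chain` — **THE ENGINE**: after a pop of the front `k` at `τ ≥ H`, if items `k+1, …, k+L-1` are R-items and some later
  non-defect position `s < E` already has `pops ≥ k + L`, then for `1 ≤ i ≤ L` the `i`-th non-defect position after `τ` has
  `pops = k + i`, lies `≤ s`, and for `i < L` it is `< s` and carries a pop (the R-item `k+i` is shed there);
* `posColour_eq_of_pop` — at a pop position of a respecting balanced word the colour is the front item's push colour;
* `posColour_eq_of_not_isTest` — at a fair non-test position the colour is the front item's push colour;
* `gate_data` — what a gate at `j` says about the items and the positions, in item language (`openTime`, `isRItem`).

Honest framing: bookkeeping over the landed definitions; nothing here proves S2b, the crux or VP ≠ VNP (not proved).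
No new definitions. [folklore]
-/

noncomputable section

-- Sub = Summit single-conjunct layout: the duplicated namespace component is mandated by the tree.
set_option linter.dupNamespace false

namespace Summit.ValiantsHypothesis.ValiantsHypothesis.Theorems.FifoMatching.NNLinearDegreeCofactorHard.ShedWord

open Finset Literature.Computability.AlgebraicComplexity
open Summit.ValiantsHypothesis.ValiantsHypothesis.Theorems.FifoMatching.NNMonotoneHard
open Summit.ValiantsHypothesis.ValiantsHypothesis.Theorems.FifoMatching.NNLinearDegreeCofactorHard.QueueHistory
open Summit.ValiantsHypothesis.ValiantsHypothesis.Theorems.FifoMatching.NNLinearDegreeCofactorHard.CondProbBits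

variable {N : ℕ} (R : Finset (Fin N)) (H E : ℕ) (y : Fin N → Bool) (S : Finset (Fin N))

/-! ### Pop times -/

/-- `t ≤ closeTime k` iff item `k` is not popped before `t`. [folklore] -/
theorem le_closeTime_iff (hbal : (closerSet (shedWord R H E y)).card = (openerSet (shedWord R H E y)).card) {k : ℕ}
    (hk : k < (openerSet (shedWord R H E y)).card) (t : ℕ) :
    t ≤ closeTime R H E y hbal k ↔ pops (shedPrefix R H E y t) ≤ k := by
  rw [← not_lt, closeTime_lt_iff R H E y hbal hk, not_lt]

/-- At the pop time of item `k` exactly `k` items have been popped. [folklore] -/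
theorem pops_closeTime (hbal : (closerSet (shedWord R H E y)).card = (openerSet (shedWord R H E y)).card) {k : ℕ}
    (hk : k < (openerSet (shedWord R H E y)).card) : pops (shedPrefix R H E y (closeTime R H E y hbal k)) = k := by
  apply le_antisymm ((le_closeTime_iff R H E y hbal hk _).1 le_rfl)
  have h1 : k < pops (shedPrefix R H E y (closeTime R H E y hbal k + 1)) :=
    (closeTime_lt_iff R H E y hbal hk _).1 (Nat.lt_succ_self _)
  have h2 := rankC_succ R H E y (closeTime R H E y hbal k)
  split_ifs at h2 <;> omega

/-- The letter at the pop time of item `k` is a pop. [folklore] -/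
theorem shedLetter_closeTime (hbal : (closerSet (shedWord R H E y)).card = (openerSet (shedWord R H E y)).card) {k : ℕ}
    (hk : k < (openerSet (shedWord R H E y)).card) : shedLetter R H E y (closeTime R H E y hbal k) = false := by
  have h0 := pops_closeTime R H E y hbal hk
  have h1 : k < pops (shedPrefix R H E y (closeTime R H E y hbal k + 1)) :=
    (closeTime_lt_iff R H E y hbal hk _).1 (Nat.lt_succ_self _)
  have h2 := rankC_succ R H E y (closeTime R H E y hbal k)
  by_contra hne
  rw [Bool.not_eq_false] at hne
  rw [if_pos hne] at h2
  omega

/-- Pop times increase with the item. [folklore] -/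
theorem closeTime_lt_closeTime (hbal : (closerSet (shedWord R H E y)).card = (openerSet (shedWord R H E y)).card)
    {k k' : ℕ} (hkk' : k < k') (hk' : k' < (openerSet (shedWord R H E y)).card) :
    closeTime R H E y hbal k < closeTime R H E y hbal k' := by
  have hk : k < (openerSet (shedWord R H E y)).card := hkk'.trans hk'
  by_contra hle
  rw [not_lt, le_closeTime_iff R H E y hbal hk] at hle
  have := pops_closeTime R H E y hbal hk'
  omega

/-- A pop letter is not at a defect. [folklore] -/
theorem isDefect_eq_false_of_pop {t : ℕ} (h : shedLetter R H E y t = false) : isDefect R t = false :=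
  (pops_lt_pushes_of_shedLetter_eq_false R H E y h).1

/-- A pop advances the pop count by one. [folklore] -/
theorem pops_succ_of_pop {t : ℕ} (h : shedLetter R H E y t = false) :
    pops (shedPrefix R H E y (t + 1)) = pops (shedPrefix R H E y t) + 1 := by
  rw [rankC_succ, if_neg (by simp [h])]

/-- A push keeps the pop count. [folklore] -/
theorem pops_succ_of_push {t : ℕ} (h : shedLetter R H E y t = true) :
    pops (shedPrefix R H E y (t + 1)) = pops (shedPrefix R H E y t) := by
  rw [rankC_succ, if_pos h]; rfl

/-- Pops do not move across a run of defects. [folklore] -/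
theorem pops_eq_of_defects {u v : ℕ} (huv : u ≤ v) (hd : ∀ r, u ≤ r → r < v → isDefect R r = true) :
    pops (shedPrefix R H E y v) = pops (shedPrefix R H E y u) := by
  induction v, huv using Nat.le_induction with
  | base => rfl
  | succ v huv ih =>
    rw [pops_succ_of_push R H E y (shedLetter_of_isDefect R H E y (hd v huv (Nat.lt_succ_self v))),
      ih fun r h1 h2 => hd r h1 (Nat.lt_succ_of_lt h2)]

/-- Pops at the next non-defect position equal pops right after `t`. [folklore] -/
theorem pops_nextFree (t : ℕ) : pops (shedPrefix R H E y (nextFree R t)) = pops (shedPrefix R H E y (t + 1)) :=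
  pops_eq_of_defects R H E y (lt_nextFree R t) fun _ h1 h2 => isDefect_of_lt_nextFree R h1 h2

/-! ### Colours at pops and at non-tests -/

/-- At a pop position of a respecting balanced word the colour is the push colour of the front item. [folklore] -/
theorem posColour_eq_of_pop (hbal : (closerSet (shedWord R H E y)).card = (openerSet (shedWord R H E y)).card)
    (hresp : ∀ i, i ∈ S ↔ fifo (shedWord R H E y) hbal i ∈ S) {t : ℕ} (ht : t < N) (hpop : shedLetter R H E y t = false) :
    posColour S t = posColour S (openTime R H E y (pops (shedPrefix R H E y t))) := by
  rw [posColour_pop R H E y S hbal hresp ht hpop,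
    frontPos_eq_openTime R H E y ht.le (pops_lt_pushes_of_shedLetter_eq_false R H E y hpop).2.2]

/-- At a fair position that is not a test the colour is the push colour of the front item. [folklore] -/
theorem posColour_eq_of_not_isTest {t : ℕ} (ht : t ≤ N) (hfair : isFair R H E y t = true)
    (hnt : isTest R H E y S t = false) : posColour S t = posColour S (openTime R H E y (pops (shedPrefix R H E y t))) := by
  have hne := ((isFair_iff R H E y t).1 hfair).2.2.1
  unfold isTest at hnt
  rw [hfair, Bool.true_and] at hnt
  rw [← frontPos_eq_openTime R H E y ht hne]
  simpa using hnt

/-- In the band the queue holds an S-item at every time of `[H, E]`; in particular it is non-empty. [folklore] -/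
theorem pops_lt_pushes_of_band (hEN : E ≤ N) {w : ℕ} (hw : w ≤ freeCount R 0 H)
    (hband : ∀ s, H ≤ s → s ≤ E → |fairWalk R H E y s| < w) {t : ℕ} (hHt : H ≤ t) (htE : t ≤ E) :
    pops (shedPrefix R H E y t) < pushes (shedPrefix R H E y t) :=
  (sContent_mem_band R H E y hEN hw hHt htE fun s h1 h2 => hband s h1 (h2.trans htE)).2

/-- A fair position from its ingredients in item language. [folklore] -/
theorem isFair_of (hEN : E ≤ N) {w : ℕ} (hw : w ≤ freeCount R 0 H)
    (hband : ∀ s, H ≤ s → s ≤ E → |fairWalk R H E y s| < w) {t : ℕ} (hd : isDefect R t = false) (hHt : H ≤ t)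
    (htE : t < E) (hS : isRItem R H E y (pops (shedPrefix R H E y t)) = false) : isFair R H E y t = true := by
  have hne := pops_lt_pushes_of_band R H E y hEN hw hband hHt htE.le
  rw [isFair_iff]
  refine ⟨hd, hHt, hne, htE, ?_⟩
  rwa [← isRItem_pops R H E y (htE.le.trans hEN) hne]

/-! ### The engine -/

/-- **THE ENGINE.**  After a pop of the front `k = pops (prefix τ)` at `τ ≥ H` in the band: if items `k+1, …, k+L-1` are
R-items and a later non-defect position `s < E` has `pops (prefix s) ≥ k + L`, then for every `i ≤ L` the `i`-th non-defect
position after `τ` lies `≤ s`, has `pops = k + i`, and for `i < L` lies `< s` and carries a pop. [folklore] -/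
theorem chain (hEN : E ≤ N) {w : ℕ} (hw : w ≤ freeCount R 0 H)
    (hband : ∀ s, H ≤ s → s ≤ E → |fairWalk R H E y s| < w) {τ : ℕ} (hHτ : H ≤ τ)
    (hpop : shedLetter R H E y τ = false) {L : ℕ}
    (hR : ∀ l, 1 ≤ l → l < L → isRItem R H E y (pops (shedPrefix R H E y τ) + l) = true)
    {s : ℕ} (hτs : τ < s) (hsE : s < E) (hs : isDefect R s = false)
    (hLs : pops (shedPrefix R H E y τ) + L ≤ pops (shedPrefix R H E y s)) :
    ∀ i, i ≤ L → freeIter R τ i ≤ s ∧ pops (shedPrefix R H E y (freeIter R τ i)) = pops (shedPrefix R H E y τ) + i ∧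
      (i < L → freeIter R τ i < s ∧ shedLetter R H E y (freeIter R τ i) = false) := by
  intro i
  induction i with
  | zero =>
    intro _
    rw [freeIter_zero]
    exact ⟨hτs.le, rfl, fun _ => ⟨hτs, hpop⟩⟩
  | succ i ih =>
    intro hiL
    obtain ⟨_, hpopsi, hlt⟩ := ih (Nat.le_of_succ_le hiL)
    obtain ⟨hqs, hpopq⟩ := hlt (Nat.lt_of_succ_le hiL)
    -- the next non-defect position
    have hle : freeIter R τ (i + 1) ≤ s := by rw [freeIter_succ]; exact nextFree_le R hqs hs
    have hpops : pops (shedPrefix R H E y (freeIter R τ (i + 1))) = pops (shedPrefix R H E y τ) + (i + 1) := by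
      rw [freeIter_succ, pops_nextFree, pops_succ_of_pop R H E y hpopq, hpopsi, add_assoc]
    refine ⟨hle, hpops, fun hi1 => ?_⟩
    have hlt' : freeIter R τ (i + 1) < s := by
      rcases hle.lt_or_eq with h | h
      · exact h
      · exfalso; rw [h] at hpops; omega
    refine ⟨hlt', ?_⟩
    -- the front `k + i + 1` is an R-item: it is shed
    have hHq : H ≤ freeIter R τ (i + 1) := by
      have := freeIter_le_freeIter R (t := τ) (Nat.zero_le (i + 1)); rw [freeIter_zero] at this; exact hHτ.trans this
    have hqE : freeIter R τ (i + 1) < E := hlt'.trans hsE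
    have hne := pops_lt_pushes_of_band R H E y hEN hw hband hHq hqE.le
    apply shedLetter_shed R H E y (isDefect_freeIter R (Nat.succ_pos i)) hHq hne hqE
    rw [← isRItem_pops R H E y (hqE.le.trans hEN) hne, hpops]
    exact hR (i + 1) (Nat.succ_pos i) hi1

/-! ### What a gate says, in item language -/

/-- **Gate data.**  At a gate `j ≤ N` with front `k` and look-ahead length `L`: `k + L` is pushed, the items `k + l`
(`1 ≤ l < L`) are R-items of the front's colour, item `k + L` has a different colour, the `L`-th non-defect position after `j`
is `< E`, and the colours of the non-defect positions `l ≤ L` after `j` are the push colours of the items `k + l`. [folklore] -/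
theorem gate_data {j : ℕ} (hjN : j ≤ N) (hg : isGate R H E y S j = true) :
    pops (shedPrefix R H E y j) + lookLenL R S (shedPrefix R H E y j) < pushes (shedPrefix R H E y j) ∧
    (∀ l, 1 ≤ l → l < lookLenL R S (shedPrefix R H E y j) →
      isRItem R H E y (pops (shedPrefix R H E y j) + l) = true ∧
        posColour S (openTime R H E y (pops (shedPrefix R H E y j) + l)) =
          posColour S (openTime R H E y (pops (shedPrefix R H E y j)))) ∧
    posColour S (openTime R H E y (pops (shedPrefix R H E y j) + lookLenL R S (shedPrefix R H E y j))) ≠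
      posColour S (openTime R H E y (pops (shedPrefix R H E y j))) ∧
    freeIter R j (lookLenL R S (shedPrefix R H E y j)) < E ∧
    ∀ l, l ≤ lookLenL R S (shedPrefix R H E y j) →
      posColour S (freeIter R j l) = posColour S (openTime R H E y (pops (shedPrefix R H E y j) + l)) := by
  rw [isGate_iff, goodExitL_iff] at hg
  obtain ⟨hfair, hpush, hcol, hE, hcols⟩ := hg
  have hne := ((isFair_iff R H E y j).1 hfair).2.2.1
  have hk0 : pops (shedPrefix R H E y j) + 0 < pushes (shedPrefix R H E y j) := by rw [add_zero]; exact hne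
  have hc0 : pcolL S (shedPrefix R H E y j) (pops (shedPrefix R H E y j)) =
      posColour S (openTime R H E y (pops (shedPrefix R H E y j))) := pcolL_eq R H E y S hjN hne
  refine ⟨hpush, fun l hl1 hl => ?_, ?_, hE, fun l hl => ?_⟩
  · obtain ⟨h1, h2, h3⟩ := lookLenL_min R S (shedPrefix R H E y j) hl1 hl
    refine ⟨?_, ?_⟩
    · rwa [pRL_eq R H E y hjN h1] at h3
    · rwa [pcolL_eq R H E y S hjN h1, hc0] at h2
  · rwa [pcolL_eq R H E y S hjN hpush, hc0] at hcol
  · rw [hcols l hl]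
    exact pcolL_eq R H E y S hjN (lt_of_le_of_lt (Nat.add_le_add_left hl _) hpush)

/-- The look-ahead length of a gate is at most the distance to the next S-item. [folklore] -/
theorem lookLenL_le_of_isRItem_eq_false {j : ℕ} (hjN : j ≤ N) {m : ℕ} (hm1 : 1 ≤ m)
    (hm : pops (shedPrefix R H E y j) + m < pushes (shedPrefix R H E y j))
    (hS : isRItem R H E y (pops (shedPrefix R H E y j) + m) = false) :
    lookLenL R S (shedPrefix R H E y j) ≤ m := by
  unfold lookLenL
  apply Nat.find_min'
  refine ⟨hm1, Or.inr (Or.inr ?_)⟩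
  rwa [pRL_eq R H E y hjN hm]

end Summit.ValiantsHypothesis.ValiantsHypothesis.Theorems.FifoMatching.NNLinearDegreeCofactorHard.ShedWord

end
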